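import Mathlib
import Summits.MatrixMultiplication.MatrixMultiplication.Theorems.SnSubsetDichotomyPolynomialSlackPolylogPower

/-!
# `SnSubsetDichotomy.PolynomialSlack`, line `transport-split-hull` — stub `eventually_small_errors`

The "`n` large enough" side conditions of the induction on `n` behind the polynomial-slack
thesis beyond one half (crux `stmt-MatrixMultiplication-8306`, registered stub
`eventually_small_errors` of `Cruxes/PolynomialSlack/Lines/transport-split-hull.lean`).
With `C₁ = 1/2 + ε`, scale exponent `m = ε + 1/24` (`0 < ε < 1/24`), `G = 1 + log n`,
`L = log (256 n³)` and `Λ = 200 G L`, the three explicit level-one error terms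
`8 n^{C₁} √6 / √(n(n-1))`, `8 n^{C₁} · 30 √(G L / n^m) / √(n-1)` and
`8 Λ² (n^m)² √(n^m) n / ((n-1) √(n-1))` eventually sum to at most `1 / (64 Λ²)`, and
`16384 (n^m)³ ≤ n - 1`, for all `n ≥ n₁` (with `n₁ ≥ 40`).

Proof.  `L = log 256 + 3 log n ≤ 6 G` (`log 256 = 8 log 2 < 6`), so `Λ ≤ 1200 G²`; for `n ≥ 2`
one has `n - 1 ≥ n / 2`, `√(n(n-1)) ≥ n - 1` and `√n ≤ 2 √(n-1)`.  Each error term times `192 Λ²`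
is then at most `c · G^k · n^p` for an exponent `p` strictly below the exponent `q` of the
available denominator (`q = 1`, `q = 1/2 + m/2`, `q = 3/2` respectively; the gaps are
`1/2 - ε`, `1/48 - ε/2`, `1/2 - 5m/2`, all positive as `ε < 1/24`), and the master lemma
`eventually_log_pow_mul_rpow_le` (`c (1 + log n)^k n^p ≤ n^q` eventually) closes each of them;
likewise `32768 n^{3m} ≤ n` eventually gives `16384 (n^m)³ ≤ n/2 ≤ n - 1`.  The threshold `n₁` is
the maximum of `40` and the four thresholds.
-/

namespace Summit.MatrixMultiplication.MatrixMultiplication.Theorems.PolynomialSlack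

-- `Summit.<Summit>.<Problem>` is the tree's mandated summit-side namespace; for this
-- single-conjunct summit the two coincide, so the file silences `dupNamespace`.
set_option linter.dupNamespace false

/-- `log (256 x³) ≤ 6 (1 + log x)` for `x ≥ 1` (`log 256 = 8 log 2 < 6` by `Real.log_two_lt_d9`,
`log (x³) = 3 log x ≤ 6 log x`). [folklore] -/
theorem smallErrors_log_cube_le {x : ℝ} (hx : 1 ≤ x) :
    Real.log (256 * x ^ 3) ≤ 6 * (1 + Real.log x) := by
  have hx0 : 0 < x := by linarith
  rw [Real.log_mul (by norm_num) (by positivity), Real.log_pow,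
    show (256 : ℝ) = 2 ^ 8 by norm_num, Real.log_pow]
  push_cast
  have h2 := Real.log_two_lt_d9
  have hl := Real.log_nonneg hx
  linarith

/-- `0 < log (256 x³)` for `x ≥ 1`. [folklore] -/
theorem smallErrors_log_cube_pos {x : ℝ} (hx : 1 ≤ x) : 0 < Real.log (256 * x ^ 3) := by
  apply Real.log_pos
  have h3 : 1 ≤ x ^ 3 := one_le_pow₀ hx
  linarith

/-- `√x ≤ 2 √(x - 1)` for `x ≥ 2` (indeed `x ≤ 4 (x - 1)`). [folklore] -/
theorem smallErrors_sqrt_le_two_mul_sqrt_sub_one {x : ℝ} (hx : 2 ≤ x) :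
    Real.sqrt x ≤ 2 * Real.sqrt (x - 1) := by
  calc Real.sqrt x ≤ Real.sqrt (2 ^ 2 * (x - 1)) := Real.sqrt_le_sqrt (by linarith)
    _ = 2 * Real.sqrt (x - 1) := by
        rw [Real.sqrt_mul (by norm_num), Real.sqrt_sq (by norm_num)]

/-- The cubic side condition: `32768 x^{3m} ≤ x` and `x ≥ 2` give `16384 (x^m)³ ≤ x - 1`.
[folklore] -/
theorem smallErrors_cube_le {x m : ℝ} (hx : 2 ≤ x) (h0 : 32768 * (x ^ m * x ^ m * x ^ m) ≤ x) :
    16384 * (x ^ m) ^ 3 ≤ x - 1 := by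
  have hcube : (x ^ m) ^ 3 = x ^ m * x ^ m * x ^ m := by ring
  rw [hcube]
  linarith

/-- First error term: if `Λ ≤ 1200 G²` and `9216 · 1200² · G⁴ · P ≤ x` with `x ≥ 2`, then
`8 P √6 / √(x (x - 1)) ≤ 1 / (192 Λ²)` (`√6 ≤ 3`, `√(x(x-1)) ≥ x - 1 ≥ x / 2`). [folklore] -/
theorem smallErrors_term₁_le {x P Λ G : ℝ} (hx : 2 ≤ x) (hP : 0 ≤ P) (hΛ : 0 < Λ)
    (hΛG : Λ ≤ 1200 * G ^ 2) (h1 : 9216 * 1200 ^ 2 * G ^ 4 * P ≤ x) :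
    8 * P * (Real.sqrt 6 / Real.sqrt (x * (x - 1))) ≤ 1 / (192 * Λ ^ 2) := by
  have hx0 : 0 < x := by linarith
  have hx1 : 0 < x - 1 := by linarith
  have h6 : Real.sqrt 6 ≤ 3 := by
    calc Real.sqrt 6 ≤ Real.sqrt (3 ^ 2) := Real.sqrt_le_sqrt (by norm_num)
      _ = 3 := Real.sqrt_sq (by norm_num)
  have hden : x - 1 ≤ Real.sqrt (x * (x - 1)) := by
    calc x - 1 = Real.sqrt ((x - 1) ^ 2) := (Real.sqrt_sq hx1.le).symm
      _ ≤ Real.sqrt (x * (x - 1)) := Real.sqrt_le_sqrt (by nlinarith)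
  have hpos : 0 < Real.sqrt (x * (x - 1)) := Real.sqrt_pos.2 (mul_pos hx0 hx1)
  rw [mul_div_assoc', div_le_div_iff₀ hpos (by positivity)]
  calc 8 * P * Real.sqrt 6 * (192 * Λ ^ 2) ≤ 8 * P * 3 * (192 * (1200 * G ^ 2) ^ 2) := by gcongr
    _ = 9216 * 1200 ^ 2 * G ^ 4 * P / 2 := by ring
    _ ≤ x / 2 := by gcongr
    _ ≤ 1 * Real.sqrt (x * (x - 1)) := by linarith

/-- Second error term: if `L ≤ 6 G`, `Λ ≤ 1200 G²` and `276480 · 1200² · G⁵ · P ≤ √x · √M` with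
`x ≥ 2`, then `8 P · 30 √(G L / M) / √(x - 1) ≤ 1 / (192 Λ²)` (`√(G L) ≤ 3 G`,
`√x ≤ 2 √(x - 1)`). [folklore] -/
theorem smallErrors_term₂_le {x P M Λ G L : ℝ} (hx : 2 ≤ x) (hP : 0 ≤ P) (hM : 0 < M)
    (hΛ : 0 < Λ) (hG : 1 ≤ G) (hL0 : 0 ≤ L) (hL : L ≤ 6 * G) (hΛG : Λ ≤ 1200 * G ^ 2)
    (h2 : 276480 * 1200 ^ 2 * G ^ 5 * P ≤ Real.sqrt x * Real.sqrt M) :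
    8 * P * (30 * Real.sqrt (G * L / M) / Real.sqrt (x - 1)) ≤ 1 / (192 * Λ ^ 2) := by
  have hx1 : 0 < x - 1 := by linarith
  have hG0 : 0 ≤ G := by linarith
  have hGL : Real.sqrt (G * L) ≤ 3 * G := by
    calc Real.sqrt (G * L) ≤ Real.sqrt ((3 * G) ^ 2) :=
          Real.sqrt_le_sqrt (by nlinarith [mul_le_mul_of_nonneg_left hL hG0])
      _ = 3 * G := Real.sqrt_sq (by linarith)
  have hsx := smallErrors_sqrt_le_two_mul_sqrt_sub_one hx
  have hsM : 0 < Real.sqrt M := Real.sqrt_pos.2 hM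
  have hs1 : 0 < Real.sqrt (x - 1) := Real.sqrt_pos.2 hx1
  have key : 8 * P * (30 * Real.sqrt (G * L / M) / Real.sqrt (x - 1)) =
      240 * P * Real.sqrt (G * L) / (Real.sqrt M * Real.sqrt (x - 1)) := by
    rw [Real.sqrt_div (mul_nonneg hG0 hL0)]
    ring
  rw [key, div_le_div_iff₀ (mul_pos hsM hs1) (by positivity)]
  calc 240 * P * Real.sqrt (G * L) * (192 * Λ ^ 2)
      ≤ 240 * P * (3 * G) * (192 * (1200 * G ^ 2) ^ 2) := by gcongr
    _ = 276480 * 1200 ^ 2 * G ^ 5 * P * (1 / 2) := by ring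
    _ ≤ Real.sqrt x * Real.sqrt M * (1 / 2) := by gcongr
    _ ≤ 2 * Real.sqrt (x - 1) * Real.sqrt M * (1 / 2) := by gcongr
    _ = 1 * (Real.sqrt M * Real.sqrt (x - 1)) := by ring

/-- Third error term: if `Λ ≤ 1200 G²` and `6144 · 1200⁴ · G⁸ · (M · M · √M · x) ≤ x √x` with
`x ≥ 2`, then `8 Λ² M² √M x / ((x - 1) √(x - 1)) ≤ 1 / (192 Λ²)`
(`x √x ≤ 4 (x - 1) √(x - 1)`). [folklore] -/
theorem smallErrors_term₃_le {x M Λ G : ℝ} (hx : 2 ≤ x) (hM : 0 < M) (hΛ : 0 < Λ)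
    (hΛG : Λ ≤ 1200 * G ^ 2)
    (h3 : 6144 * 1200 ^ 4 * G ^ 8 * (M * M * Real.sqrt M * x) ≤ x * Real.sqrt x) :
    8 * Λ ^ 2 * M ^ 2 * Real.sqrt M * x / ((x - 1) * Real.sqrt (x - 1)) ≤
      1 / (192 * Λ ^ 2) := by
  have hx0 : 0 < x := by linarith
  have hx1 : 0 < x - 1 := by linarith
  have hsx := smallErrors_sqrt_le_two_mul_sqrt_sub_one hx
  have hs1 : 0 < Real.sqrt (x - 1) := Real.sqrt_pos.2 hx1
  have hxx : x * Real.sqrt x ≤ 2 * (x - 1) * (2 * Real.sqrt (x - 1)) :=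
    mul_le_mul (by linarith) hsx (Real.sqrt_nonneg x) (by linarith)
  rw [div_le_div_iff₀ (mul_pos hx1 hs1) (by positivity)]
  calc 8 * Λ ^ 2 * M ^ 2 * Real.sqrt M * x * (192 * Λ ^ 2)
      ≤ 8 * (1200 * G ^ 2) ^ 2 * M ^ 2 * Real.sqrt M * x * (192 * (1200 * G ^ 2) ^ 2) := by
        gcongr
    _ = 6144 * 1200 ^ 4 * G ^ 8 * (M * M * Real.sqrt M * x) * (1 / 4) := by ring
    _ ≤ x * Real.sqrt x * (1 / 4) := by gcongr
    _ ≤ 2 * (x - 1) * (2 * Real.sqrt (x - 1)) * (1 / 4) :=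
        mul_le_mul_of_nonneg_right hxx (by norm_num)
    _ = 1 * ((x - 1) * Real.sqrt (x - 1)) := by ring

/-- Real-variable assembly: from the four instances of the master polylog-versus-power
comparison (in the raw `Real.rpow` form in which `eventually_log_pow_mul_rpow_le` delivers them)
at a real `x ≥ 2`, both the cubic side condition and the bound `≤ 1 / (64 Λ²)` on the sum of the
three error terms follow. [folklore] -/
theorem smallErrors_of_master {x m C₁ : ℝ} (hx : 2 ≤ x)
    (h0 : 32768 * (1 + Real.log x) ^ 0 * x ^ (m + m + m) ≤ x ^ (1 : ℝ))
    (h1 : 9216 * 1200 ^ 2 * (1 + Real.log x) ^ 4 * x ^ C₁ ≤ x ^ (1 : ℝ))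
    (h2 : 276480 * 1200 ^ 2 * (1 + Real.log x) ^ 5 * x ^ C₁ ≤ x ^ (1 / 2 + m * (1 / 2)))
    (h3 : 6144 * 1200 ^ 4 * (1 + Real.log x) ^ 8 * x ^ (m + m + m * (1 / 2) + 1) ≤
      x ^ (1 + 1 / 2 : ℝ)) :
    16384 * (x ^ m) ^ 3 ≤ x - 1 ∧
      8 * x ^ C₁ * (Real.sqrt 6 / Real.sqrt (x * (x - 1)) +
          30 * Real.sqrt ((1 + Real.log x) * Real.log (256 * x ^ 3) / x ^ m) /
            Real.sqrt (x - 1)) +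
        8 * (200 * (1 + Real.log x) * Real.log (256 * x ^ 3)) ^ 2 * (x ^ m) ^ 2 *
          Real.sqrt (x ^ m) * x / ((x - 1) * Real.sqrt (x - 1)) ≤
        1 / (64 * (200 * (1 + Real.log x) * Real.log (256 * x ^ 3)) ^ 2) := by
  have hx0 : 0 < x := by linarith
  have hx1 : 1 ≤ x := by linarith
  have hG : 1 ≤ 1 + Real.log x := by
    have := Real.log_nonneg hx1
    linarith
  have hL0 : 0 < Real.log (256 * x ^ 3) := smallErrors_log_cube_pos hx1
  have hL : Real.log (256 * x ^ 3) ≤ 6 * (1 + Real.log x) := smallErrors_log_cube_le hx1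
  have hM : 0 < x ^ m := Real.rpow_pos_of_pos hx0 m
  have hP : 0 ≤ x ^ C₁ := Real.rpow_nonneg hx0.le C₁
  have hΛ : 0 < 200 * (1 + Real.log x) * Real.log (256 * x ^ 3) :=
    mul_pos (mul_pos (by norm_num) (by linarith)) hL0
  have hΛG : 200 * (1 + Real.log x) * Real.log (256 * x ^ 3) ≤ 1200 * (1 + Real.log x) ^ 2 := by
    calc 200 * (1 + Real.log x) * Real.log (256 * x ^ 3)
        ≤ 200 * (1 + Real.log x) * (6 * (1 + Real.log x)) :=
          mul_le_mul_of_nonneg_left hL (by linarith)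
      _ = 1200 * (1 + Real.log x) ^ 2 := by ring
  -- bring the master inequalities to the `Real.sqrt` / monomial form of the term lemmas
  simp only [pow_zero, mul_one, Real.rpow_add hx0, Real.rpow_one] at h0
  rw [Real.rpow_one] at h1
  rw [Real.rpow_add hx0, Real.rpow_mul hx0.le, ← Real.sqrt_eq_rpow, ← Real.sqrt_eq_rpow] at h2
  simp only [Real.rpow_add hx0, Real.rpow_one] at h3
  rw [Real.rpow_mul hx0.le, ← Real.sqrt_eq_rpow, ← Real.sqrt_eq_rpow] at h3
  refine ⟨smallErrors_cube_le hx h0, ?_⟩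
  have e1 := smallErrors_term₁_le hx hP hΛ hΛG h1
  have e2 := smallErrors_term₂_le hx hP hM hΛ hG hL0.le hL hΛG h2
  have e3 := smallErrors_term₃_le hx hM hΛ hΛG h3
  have hr : ∀ r : ℝ, 1 / (192 * r) + 1 / (192 * r) + 1 / (192 * r) = 1 / (64 * r) := by
    intro r
    ring
  rw [mul_add]
  exact (add_le_add (add_le_add e1 e2) e3).trans_eq (hr _)

/-- **The error terms are eventually small** (registered stub `eventually_small_errors` of line
`transport-split-hull`): for `0 < ε < 1/24`, `C₁ = 1/2 + ε` and `m = ε + 1/24` there is `n₁`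
such that for all `n ≥ n₁` one has `40 ≤ n`, `16384 (n^m)³ ≤ n - 1`, and the three level-one
error terms at scale `n^m` sum to at most `1 / (64 Λ²)` with `Λ = 200 (1 + log n) log (256 n³)`
(four instances of `eventually_log_pow_mul_rpow_le`, assembled by `smallErrors_of_master`).
[folklore] -/
theorem eventually_small_errors (ε : ℝ) (hε0 : 0 < ε) (hε1 : ε < 1 / 24) (C₁ m : ℝ)
    (hC₁ : C₁ = 1 / 2 + ε) (hm : m = ε + 1 / 24) :
    ∃ n₁ : ℕ, ∀ n : ℕ, n₁ ≤ n →
      40 ≤ n ∧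
      16384 * ((n : ℝ) ^ m) ^ 3 ≤ (n : ℝ) - 1 ∧
      8 * (n : ℝ) ^ C₁ * (Real.sqrt 6 / Real.sqrt ((n : ℝ) * ((n : ℝ) - 1)) +
          30 * Real.sqrt ((1 + Real.log n) * Real.log (256 * (n : ℝ) ^ 3) / (n : ℝ) ^ m) /
            Real.sqrt ((n : ℝ) - 1)) +
        8 * (200 * (1 + Real.log n) * Real.log (256 * (n : ℝ) ^ 3)) ^ 2 * ((n : ℝ) ^ m) ^ 2 *
          Real.sqrt ((n : ℝ) ^ m) * n / (((n : ℝ) - 1) * Real.sqrt ((n : ℝ) - 1)) ≤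
        1 / (64 * (200 * (1 + Real.log n) * Real.log (256 * (n : ℝ) ^ 3)) ^ 2) := by
  obtain ⟨N₀, hN₀⟩ :=
    eventually_log_pow_mul_rpow_le 0 (m + m + m) 1 32768 (by linarith) (by norm_num)
  obtain ⟨N₁, hN₁⟩ :=
    eventually_log_pow_mul_rpow_le 4 C₁ 1 (9216 * 1200 ^ 2) (by linarith) (by norm_num)
  obtain ⟨N₂, hN₂⟩ :=
    eventually_log_pow_mul_rpow_le 5 C₁ (1 / 2 + m * (1 / 2)) (276480 * 1200 ^ 2)
      (by linarith) (by norm_num)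
  obtain ⟨N₃, hN₃⟩ :=
    eventually_log_pow_mul_rpow_le 8 (m + m + m * (1 / 2) + 1) (1 + 1 / 2) (6144 * 1200 ^ 4)
      (by linarith) (by norm_num)
  refine ⟨max 40 (max N₀ (max N₁ (max N₂ N₃))), fun n hn => ?_⟩
  simp only [max_le_iff] at hn
  obtain ⟨h40, hn0, hn1, hn2, hn3⟩ := hn
  have hx : (40 : ℝ) ≤ n := by exact_mod_cast h40
  exact ⟨h40, smallErrors_of_master (by linarith) (hN₀ n hn0) (hN₁ n hn1) (hN₂ n hn2) (hN₃ n hn3)⟩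

end Summit.MatrixMultiplication.MatrixMultiplication.Theorems.PolynomialSlack
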